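import Summits.AnomalousDissipation.AnomalousDissipation.Theorems.BaireTransferRobustLoudUpgradeStubCensusInterior
import Summits.AnomalousDissipation.AnomalousDissipation.Theorems.BaireTransferRobustLoudUpgradeStubSteadyWindow
import Literature.Analysis.FunctionSpaces.TorusSobolevL4
import Literature.Analysis.FunctionSpaces.TorusSobolevL6
import Literature.Analysis.FunctionSpaces.LadyzhenskayaTorus
import Literature.Analysis.FunctionSpaces.TorusFourierCalculus
import Literature.Analysis.FunctionSpaces.TorusCalculusProofs
import Literature.Analysis.FluidPDE.LerayProjectorTorusProofs
import Literature.Analysis.FluidPDE.NSCoriolisTorus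

/-!
# Sub-goal `smallData_mem_censusSteady` of the line `malkin-cone-group-orbits`
# (crux stmt-AnomalousDissipation-1144, `BaireTransfer.RobustLoudUpgrade`)

The small-data regime of the residual stub `stub_tameDense`: there is a universal `κ > 0` such that for
`ν ∈ (0,a)`, `‖f_c‖₂ ≤ κν²`, `‖f_c‖₂² < 16π⁴ν²E` and `3ε < 2ν‖∇u_S‖₂²` (`u_S` the Stokes solution of
`−νΔu_S = f_c`) EVERY mean-zero classical steady state `u` of `NS_ν(f_c)` has `∫‖u‖² < E` and
`ν‖∇u‖₂² > ε`, i.e. `c ∈ censusSteady S a E ε` — no uniqueness is used (Temam 1979, Ch. II §1):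

* the energy identity `ν‖∇u‖₂² = ∫⟪f_c, u⟫` (momentum equation tested against `u`), Cauchy–Schwarz and
  the Poincaré inequality `4π²∫‖u‖² ≤ ‖∇u‖₂²` give `16π⁴ν²∫‖u‖² ≤ 4π²ν²‖∇u‖₂² ≤ ‖f_c‖₂² < 16π⁴ν²E`;
* testing against `u_S` (smooth, solenoidal, mean zero, `νΔu_S + f_c = 0`) gives
  `ν‖∇u‖₂² = ν‖∇u_S‖₂² − b(u,u,u_S)` with `|b(u,u,u_S)| ≤ C‖∇u‖₂²‖∇u_S‖₂` (antisymmetry of `b`,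
  Hölder, Ladyzhenskaya's inequality on `T³`) and `‖∇u_S‖₂ ≤ ‖f_c‖₂/(2πν) ≤ κν/(2π)`; with
  `κ = π/(C+1)` this is `C‖∇u_S‖₂ ≤ ν/2`, so `3ν‖∇u‖₂² ≥ 2ν‖∇u_S‖₂² > 3ε`.

References: R. Temam, *Navier–Stokes Equations* (1979), Ch. II §1 ((1.9)–(1.24): steady states, a
priori bounds, smallness regime); C. Foias, O. Manley, R. Rosa, R. Temam, *Navier–Stokes Equations and
Turbulence* (2001), Ch. II App. A (A.27); the vocabulary module
`Theorems/BaireTransferRobustLoudUpgradeLine.lean`; patterns from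
`Theorems/BaireTransferRobustLoudUpgradeStubCensusInterior.lean` and `Cruxes/RobustLoudUpgrade/Disproof.lean`.
-/

-- `Summit.<Summit>.<Problem>` is the tree's mandated summit-side namespace (CONVENTIONS §2); for this
-- single-conjunct summit the two coincide, so the duplicate is deliberate.
set_option linter.dupNamespace false

noncomputable section

open scoped BigOperators Topology InnerProductSpace RealInnerProductSpace ENNReal
open Filter Set Function TopologicalSpace MeasureTheory

namespace Summit.AnomalousDissipation.AnomalousDissipation.Theorems.RobustLoudUpgrade.SmallData

open Literature.Analysis.FunctionSpaces Literature.Analysis.FunctionSpaces.Torus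
open Literature.Analysis.FluidPDE Literature.Analysis.FluidPDE.Torus

/-! ## §1 Three torus inequalities: energy–Poincaré, `L⁴`, and the trilinear form -/

/-- **Energy–Poincaré bound.** If a smooth mean-zero field `v` on `T³` satisfies the energy identity
`ν‖∇v‖₂² = ∫⟪f, v⟫` against `f ∈ L²`, then `4π²ν²‖∇v‖₂² ≤ ∫‖f‖²` (Cauchy–Schwarz and the Poincaré
inequality `4π²∫‖v‖² ≤ ‖∇v‖₂²`, `Torus.integral_norm_sq_le_gradNormSq_of_hasZeroMean`; Temam 1979,
Ch. II §1 (1.22)). [folklore] -/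
theorem gradNormSq_le_of_energy_eq {ν : ℝ} {f v : UnitAddTorus (Fin 3) → EuclideanSpace ℝ (Fin 3)}
    (hf : MemLp f 2 volume) (hv : IsSmooth v) (hv0 : HasZeroMean v)
    (h : ν * gradNormSq v = ∫ x, ⟪f x, v x⟫) :
    4 * Real.pi ^ 2 * ν ^ 2 * gradNormSq v ≤ ∫ x, ‖f x‖ ^ 2 := by
  have hG0 : 0 ≤ gradNormSq v := gradNormSq_nonneg v
  have hA0 : 0 ≤ ∫ x, ‖v x‖ ^ 2 := integral_nonneg fun _ => sq_nonneg _
  have hF0 : 0 ≤ ∫ x, ‖f x‖ ^ 2 := integral_nonneg fun _ => sq_nonneg _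
  have hP : 4 * Real.pi ^ 2 * ∫ x, ‖v x‖ ^ 2 ≤ gradNormSq v :=
    Torus.integral_norm_sq_le_gradNormSq_of_hasZeroMean hv hv0
  have h1 : (ν * gradNormSq v) ^ 2 ≤ (∫ x, ‖f x‖ ^ 2) * ∫ x, ‖v x‖ ^ 2 := by
    have h2 : |ν * gradNormSq v| ≤ Real.sqrt (∫ x, ‖f x‖ ^ 2) * Real.sqrt (∫ x, ‖v x‖ ^ 2) := by
      rw [h]; exact abs_integral_inner_le_sqrt_mul_sqrt hf (hv.memLp 2)
    calc (ν * gradNormSq v) ^ 2 = |ν * gradNormSq v| ^ 2 := (sq_abs _).symm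
      _ ≤ (Real.sqrt (∫ x, ‖f x‖ ^ 2) * Real.sqrt (∫ x, ‖v x‖ ^ 2)) ^ 2 :=
          pow_le_pow_left₀ (abs_nonneg _) h2 2
      _ = (∫ x, ‖f x‖ ^ 2) * ∫ x, ‖v x‖ ^ 2 := by
          rw [mul_pow, Real.sq_sqrt hF0, Real.sq_sqrt hA0]
  have hπ : (0 : ℝ) ≤ 4 * Real.pi ^ 2 := by positivity
  rcases eq_or_lt_of_le hG0 with hG' | hGpos
  · rw [← hG', mul_zero]; exact hF0
  · have h4 : 4 * Real.pi ^ 2 * ν ^ 2 * gradNormSq v * gradNormSq v ≤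
        (∫ x, ‖f x‖ ^ 2) * gradNormSq v := by
      nlinarith [mul_le_mul_of_nonneg_left h1 hπ, mul_le_mul_of_nonneg_left hP hF0]
    exact le_of_mul_le_mul_right h4 hGpos

/-- `∫‖Dv‖² ≤ 3‖∇v‖₂²` for smooth `v` on `T³` (operator norm of `Dv` against the partial derivatives,
`norm_fderiv_sq_le_card_mul_sum`). [folklore] -/
theorem integral_norm_fderiv_sq_le {v : UnitAddTorus (Fin 3) → EuclideanSpace ℝ (Fin 3)}
    (hv : IsSmooth v) : ∫ x, ‖Torus.fderiv v x‖ ^ 2 ≤ 3 * gradNormSq v := by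
  have h1 : ∀ x, ‖Torus.fderiv v x‖ ^ 2 ≤ (3 : ℝ) * ∑ i, ‖partialDeriv i v x‖ ^ 2 := fun x => by
    simpa using norm_fderiv_sq_le_card_mul_sum (hv.isContDiff (by simp)) x
  have hc2 : Continuous fun x => ∑ i, ‖partialDeriv i v x‖ ^ 2 :=
    continuous_finsetSum _ fun i _ => (hv.partialDeriv i).continuous.norm.pow 2
  calc ∫ x, ‖Torus.fderiv v x‖ ^ 2 ≤ ∫ x, (3 : ℝ) * ∑ i, ‖partialDeriv i v x‖ ^ 2 :=
        integral_mono ((continuous_fderiv_of_isSmooth hv).norm.pow 2).integrable_unitAddTorus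
          (hc2.integrable_unitAddTorus.const_mul _) h1
    _ = 3 * gradNormSq v := by rw [integral_const_mul]; rfl

/-- **`L⁴` control by the enstrophy** for smooth mean-zero fields on `T³`: there is a universal `C ≥ 0`
with `∫‖v‖⁴ ≤ C (‖∇v‖₂²)²` (Ladyzhenskaya's inequality `∫‖v‖⁴ ≤ K (∫‖v‖²)^{1/2} (∫‖Dv‖²)^{3/2}`,
`Torus.integral_norm_pow_four_le_of_hasZeroMean`, with Poincaré `∫‖v‖² ≤ ‖∇v‖₂²` and
`‖Dv‖² ≤ 3∑ᵢ‖∂ᵢv‖²`; FMRT 2001, App. A (A.27); Temam 1979, Ch. II §1.1 Lemma 1.2). [folklore] -/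
theorem exists_integral_norm_pow_four_le :
    ∃ C : ℝ, 0 ≤ C ∧ ∀ v : UnitAddTorus (Fin 3) → EuclideanSpace ℝ (Fin 3), IsSmooth v → HasZeroMean v →
      ∫ x, ‖v x‖ ^ 4 ≤ C * gradNormSq v ^ 2 := by
  obtain ⟨K, hK⟩ := Torus.integral_norm_pow_four_le_of_hasZeroMean
    (F' := EuclideanSpace ℝ (Fin 3)) (d := Fin 3) (by simp)
  refine ⟨K * (4 : ℝ) ^ (3 / 2 : ℝ), by positivity, fun v hv hv0 => ?_⟩
  have hG0 : 0 ≤ gradNormSq v := gradNormSq_nonneg v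
  have hA0 : 0 ≤ ∫ x, ‖v x‖ ^ 2 := integral_nonneg fun _ => sq_nonneg _
  have hB0 : 0 ≤ ∫ x, ‖Torus.fderiv v x‖ ^ 2 := integral_nonneg fun _ => sq_nonneg _
  have hAG : ∫ x, ‖v x‖ ^ 2 ≤ gradNormSq v := by
    have h := Torus.integral_norm_sq_le_gradNormSq_of_hasZeroMean hv hv0
    have hπ : (1 : ℝ) ≤ 4 * Real.pi ^ 2 := by nlinarith [Real.pi_gt_three]
    nlinarith
  have hBG : ∫ x, ‖Torus.fderiv v x‖ ^ 2 ≤ 4 * gradNormSq v :=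
    (integral_norm_fderiv_sq_le hv).trans (by linarith)
  calc ∫ x, ‖v x‖ ^ 4
      ≤ K * (∫ x, ‖v x‖ ^ 2) ^ (1 / 2 : ℝ) * (∫ x, ‖Torus.fderiv v x‖ ^ 2) ^ (3 / 2 : ℝ) :=
        hK v hv hv0
    _ ≤ K * gradNormSq v ^ (1 / 2 : ℝ) * (4 * gradNormSq v) ^ (3 / 2 : ℝ) := by gcongr
    _ = K * (4 : ℝ) ^ (3 / 2 : ℝ) * (gradNormSq v ^ (1 / 2 : ℝ) * gradNormSq v ^ (3 / 2 : ℝ)) := by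
        rw [Real.mul_rpow (by norm_num) hG0]; ring
    _ = K * (4 : ℝ) ^ (3 / 2 : ℝ) * gradNormSq v ^ 2 := by
        rw [← Real.rpow_add' hG0 (by norm_num), show (1 / 2 : ℝ) + 3 / 2 = 2 by norm_num,
          Real.rpow_two]

/-- **The trilinear form against a smooth field.** There is a universal `C ≥ 0` such that for every
smooth divergence-free mean-zero `u` and every smooth `w` on `T³`,
`|∫⟪(u·∇)u, w⟫| ≤ C ‖∇u‖₂² ‖∇w‖₂` (antisymmetry `∫⟪(u·∇)u, w⟫ = −∫⟪u, (u·∇)w⟫`, the pointwise bound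
`|⟪u, Dw[u]⟫| ≤ ‖u‖²‖Dw‖`, Cauchy–Schwarz, `∫‖Dw‖² ≤ 3‖∇w‖₂²` and the `L⁴` bound; Temam 1979, Ch. II
§1.1 Lemma 1.2 / (1.13)). [folklore] -/
theorem exists_abs_trilinear_le :
    ∃ C : ℝ, 0 ≤ C ∧ ∀ u w : UnitAddTorus (Fin 3) → EuclideanSpace ℝ (Fin 3), IsSmooth u →
      IsDivFree u → HasZeroMean u → IsSmooth w →
        |∫ x, ⟪convect u u x, w x⟫| ≤ C * gradNormSq u * Real.sqrt (gradNormSq w) := by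
  obtain ⟨C₁, hC₁0, hC₁⟩ := exists_integral_norm_pow_four_le
  refine ⟨Real.sqrt C₁ * Real.sqrt 3, by positivity, fun u w hu hdiv hu0 hw => ?_⟩
  have hG0 : 0 ≤ gradNormSq u := gradNormSq_nonneg u
  rw [integral_inner_convect_eq_neg hu hdiv hu hw, abs_neg]
  set φ : UnitAddTorus (Fin 3) → ℝ := fun x => ‖u x‖ ^ 2 with hφ
  set ψ : UnitAddTorus (Fin 3) → ℝ := fun x => ‖Torus.fderiv w x‖ with hψ
  have hφc : Continuous φ := hu.continuous.norm.pow 2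
  have hψc : Continuous ψ := (continuous_fderiv_of_isSmooth hw).norm
  have hpt : ∀ x, |⟪u x, convect u w x⟫| ≤ φ x * ψ x := fun x =>
    calc |⟪u x, convect u w x⟫| ≤ ‖u x‖ * ‖convect u w x‖ := abs_real_inner_le_norm _ _
      _ ≤ ‖u x‖ * (‖Torus.fderiv w x‖ * ‖u x‖) :=
          mul_le_mul_of_nonneg_left ((Torus.fderiv w x).le_opNorm (u x)) (norm_nonneg _)
      _ = φ x * ψ x := by simp only [hφ, hψ]; ring
  have h1 : |∫ x, ⟪u x, convect u w x⟫| ≤ ∫ x, φ x * ψ x :=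
    abs_integral_le_integral_abs.trans (integral_mono (hu.inner (hu.convect hw)).integrable.abs
      (hφc.mul hψc).integrable_unitAddTorus hpt)
  have hφm : MemLp φ 2 volume := hφc.memLp_of_hasCompactSupport (HasCompactSupport.of_compactSpace φ)
  have hψm : MemLp ψ 2 volume := hψc.memLp_of_hasCompactSupport (HasCompactSupport.of_compactSpace ψ)
  have h2 : ∫ x, φ x * ψ x ≤ Real.sqrt (∫ x, φ x ^ 2) * Real.sqrt (∫ x, ψ x ^ 2) := by
    have h := integral_mul_le_Lp_mul_Lq_of_nonneg Real.HolderConjugate.two_two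
      (ae_of_all _ fun x => show 0 ≤ φ x from sq_nonneg _)
      (ae_of_all _ fun x => show 0 ≤ ψ x from norm_nonneg _) (by simpa using hφm) (by simpa using hψm)
    simpa only [Real.rpow_two, one_div, Real.sqrt_eq_rpow] using h
  have h3 : ∫ x, φ x ^ 2 ≤ C₁ * gradNormSq u ^ 2 := by
    have e : ∫ x, φ x ^ 2 = ∫ x, ‖u x‖ ^ 4 :=
      integral_congr_ae (ae_of_all _ fun x => by simp only [hφ]; ring)
    rw [e]; exact hC₁ u hu hu0
  have h4 : ∫ x, ψ x ^ 2 ≤ 3 * gradNormSq w := integral_norm_fderiv_sq_le hw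
  calc |∫ x, ⟪u x, convect u w x⟫| ≤ Real.sqrt (∫ x, φ x ^ 2) * Real.sqrt (∫ x, ψ x ^ 2) :=
        h1.trans h2
    _ ≤ Real.sqrt (C₁ * gradNormSq u ^ 2) * Real.sqrt (3 * gradNormSq w) := by gcongr
    _ = Real.sqrt C₁ * Real.sqrt 3 * gradNormSq u * Real.sqrt (gradNormSq w) := by
        rw [Real.sqrt_mul hC₁0, Real.sqrt_sq hG0, Real.sqrt_mul (by norm_num : (0 : ℝ) ≤ 3)]
        ring

/-! ## §2 Classical steady states tested against smooth solenoidal fields -/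

/-- `∫⟪v, Δv⟫ = −‖∇v‖₂²` for smooth `v` (Green's first identity,
`Torus.integral_inner_laplacian_eq_neg_holds`). [folklore] -/
theorem integral_inner_laplacian_self {v : UnitAddTorus (Fin 3) → EuclideanSpace ℝ (Fin 3)}
    (hv : IsSmooth v) : ∫ x, ⟪v x, laplacian v x⟫ = -gradNormSq v := by
  have hint : ∀ i, Integrable (fun x => ‖partialDeriv i v x‖ ^ 2) volume := fun i =>
    ((hv.partialDeriv i).continuous.norm.pow 2).integrable_unitAddTorus
  rw [integral_inner_laplacian_eq_neg_holds hv, gradNormSq, integral_finsetSum _ fun i _ => hint i]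

/-- **Testing the steady momentum equation.** For a classical steady state `(u, p)` of `NS_ν(f)`
(`Torus.IsSteadyNSState`) and a smooth divergence-free `w`: `∫⟪(u·∇)u, w⟫ = ν∫⟪u, Δw⟫ + ∫⟪f, w⟫`
(the pressure drops out, `∫⟪∇p, w⟫ = 0`; Green's second identity `∫⟪Δu, w⟫ = ∫⟪u, Δw⟫`;
Temam 1979, Ch. II §1 (1.9)–(1.11)). [folklore] -/
theorem integral_inner_convect_eq_of_isSteadyNSState {ν : ℝ}
    {f u w : UnitAddTorus (Fin 3) → EuclideanSpace ℝ (Fin 3)} {p : UnitAddTorus (Fin 3) → ℝ}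
    (h : Torus.IsSteadyNSState ν f u p) (hf : IsSmooth f) (hw : IsSmooth w) (hwdiv : IsDivFree w) :
    ∫ x, ⟪convect u u x, w x⟫ = (ν * ∫ x, ⟪u x, laplacian w x⟫) + ∫ x, ⟪f x, w x⟫ := by
  have hu : IsSmooth u := h.smooth_velocity.isSmooth_slice (Set.mem_univ (0 : ℝ))
  have hp : IsSmooth p := h.smooth_pressure.isSmooth_slice (Set.mem_univ (0 : ℝ))
  have hmom : ∀ x, convect u u x = ν • laplacian u x - Torus.gradient p x + f x := fun x => by
    have h1 := h.momentum 0 (Set.mem_univ _) x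
    have h0 : Torus.timeDerivWithin Set.univ (fun _ : ℝ => u) 0 x = 0 := by
      simp [Torus.timeDerivWithin]
    rw [h0, zero_add] at h1
    exact h1
  have e : ∀ x, ⟪convect u u x, w x⟫ =
      ν * ⟪laplacian u x, w x⟫ - ⟪Torus.gradient p x, w x⟫ + ⟪f x, w x⟫ := fun x => by
    rw [hmom x, inner_add_left, inner_sub_left, real_inner_smul_left]
  simp_rw [e]
  have i1 : Integrable (fun x => ν * ⟪laplacian u x, w x⟫) volume :=
    (hu.laplacian.inner hw).integrable.const_mul ν
  have i2 : Integrable (fun x => ⟪Torus.gradient p x, w x⟫) volume := (hp.gradient.inner hw).integrable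
  have i3 : Integrable (fun x => ⟪f x, w x⟫) volume := (hf.inner hw).integrable
  have i12 : Integrable (fun x => ν * ⟪laplacian u x, w x⟫ - ⟪Torus.gradient p x, w x⟫) volume :=
    i1.sub i2
  rw [integral_add i12 i3, integral_sub i1 i2, integral_const_mul,
    integral_inner_gradient_eq_zero_of_isDivFree hw hp hwdiv, sub_zero,
    integral_inner_laplacian_comm hu hw]

/-- **Energy identity of a classical steady state**: `ν‖∇u‖₂² = ∫⟪f, u⟫` (test against `u`:
`∫⟪(u·∇)u, u⟫ = 0`, `∫⟪u, Δu⟫ = −‖∇u‖₂²`; Temam 1979, Ch. II §1 (1.21)). [folklore] -/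
theorem energy_eq_of_isSteadyNSState {ν : ℝ} {f u : UnitAddTorus (Fin 3) → EuclideanSpace ℝ (Fin 3)}
    {p : UnitAddTorus (Fin 3) → ℝ} (h : Torus.IsSteadyNSState ν f u p) (hf : IsSmooth f) :
    ν * gradNormSq u = ∫ x, ⟪f x, u x⟫ := by
  have hu : IsSmooth u := h.smooth_velocity.isSmooth_slice (Set.mem_univ (0 : ℝ))
  have hdiv : IsDivFree u := h.divFree 0 (Set.mem_univ _)
  have h1 := integral_inner_convect_eq_of_isSteadyNSState h hf hu hdiv
  rw [Torus.integral_inner_convect_self_eq_zero hu hdiv, integral_inner_laplacian_self hu] at h1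
  linarith

/-! ## §3 The Stokes solution `u_S = ∑ₖ (4π²ν|k|²)⁻¹ P_k ĉ_k eₖ` of `−νΔu_S = f_c` -/

section Stokes

variable {S : Finset (Fin 3 → ℤ)}

/-- A real rescaling `∑ₖ aₖ P_k ĉ_k eₖ` of the force coefficients is divergence free (the Leray
multiplier is transversal, `k · P_k v = 0`). [folklore] -/
theorem isDivFree_smul_force (c : Coeff S) (a : (Fin 3 → ℤ) → ℝ) :
    IsDivFree (realTrigPoly S (fun k => ((a k : ℝ) : ℂ) • Torus.lerayCoeff k (coeffExt S c k))) := by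
  -- pattern from Cruxes/RobustLoudUpgrade/Disproof.lean §2 (`isDivFree_force`)
  refine isDivFree_realTrigPoly fun k _ => ?_
  by_cases hk : k = 0
  · subst hk; simp
  · calc ∑ j, (k j : ℂ) * (((a k : ℝ) : ℂ) • Torus.lerayCoeff k (coeffExt S c k)) j
        = ((a k : ℝ) : ℂ) * ∑ j, (k j : ℂ) * (Torus.leraySym k (coeffExt S c k)) j := by
          rw [Torus.lerayCoeff_of_ne_zero hk, Finset.mul_sum]
          refine Finset.sum_congr rfl fun j _ => ?_
          rw [PiLp.smul_apply, smul_eq_mul]; ring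
      _ = 0 := by rw [Torus.sum_mul_leraySym_apply, mul_zero]

/-- A real rescaling `∑ₖ aₖ P_k ĉ_k eₖ` of the force coefficients has zero mean (its zero mode is
`a₀ P_0 ĉ_0 = 0`). [folklore] -/
theorem hasZeroMean_smul_force (c : Coeff S) (a : (Fin 3 → ℤ) → ℝ) :
    HasZeroMean (realTrigPoly S (fun k => ((a k : ℝ) : ℂ) • Torus.lerayCoeff k (coeffExt S c k))) := by
  -- pattern from Theorems/BaireTransferRobustLoudUpgradeStubCensusInterior.lean (`hasZeroMean_force`)
  set g : (Fin 3 → ℤ) → EuclideanSpace ℂ (Fin 3) :=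
    fun k => ((a k : ℝ) : ℂ) • Torus.lerayCoeff k (coeffExt S c k) with hg
  show ∫ x, EuclideanSpace.realPart (trigPoly S g x) = 0
  rw [EuclideanSpace.realPart.integral_comp_comm (continuous_trigPoly S g).integrable_unitAddTorus]
  have h : ∫ x, trigPoly S g x = 0 := by
    simp_rw [trigPoly_apply]
    rw [integral_finsetSum S (f := fun k x => UnitAddTorus.mFourier k x • g k) fun k _ =>
      ((UnitAddTorus.mFourier k).continuous.smul continuous_const).integrable_unitAddTorus]
    refine Finset.sum_eq_zero fun k _ => ?_
    rw [integral_smul_const, integral_mFourier]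
    by_cases hk : k = 0
    · subst hk; simp [hg]
    · simp [hk]
  rw [h, map_zero]

/-- **The Stokes solution.** `u_S := ∑ₖ (4π²ν|k|²)⁻¹ P_k ĉ_k eₖ` solves `νΔu_S + f_c = 0` for `ν ≠ 0`
(the Laplacian multiplies the `k`-th coefficient by `−4π²|k|²`, `laplacian_realTrigPoly`; the zero
mode of `f_c` vanishes, `lerayCoeff 0 _ = 0`). [folklore] -/
theorem stokes_eq {ν : ℝ} (hν : ν ≠ 0) (c : Coeff S) (x : UnitAddTorus (Fin 3)) :
    ν • laplacian (realTrigPoly S (fun k => (((4 * Real.pi ^ 2 * ν * freqNormSq k)⁻¹ : ℝ) : ℂ) •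
      Torus.lerayCoeff k (coeffExt S c k))) x + force S c x = 0 := by
  have hcoef : ∀ k : Fin 3 → ℤ, -(((4 * Real.pi ^ 2 * freqNormSq k : ℝ) : ℂ) •
      ((((4 * Real.pi ^ 2 * ν * freqNormSq k)⁻¹ : ℝ) : ℂ) • Torus.lerayCoeff k (coeffExt S c k))) =
        (((-ν⁻¹ : ℝ)) : ℂ) • Torus.lerayCoeff k (coeffExt S c k) := by
    intro k
    by_cases hk : k = 0
    · subst hk; simp
    · have hk' : freqNormSq k ≠ 0 := fun h0 => hk ((Torus.freqNormSq_eq_zero_iff k).1 h0)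
      rw [smul_smul, ← neg_smul]
      congr 1
      have hr : -(4 * Real.pi ^ 2 * freqNormSq k * (4 * Real.pi ^ 2 * ν * freqNormSq k)⁻¹) = -ν⁻¹ := by
        field_simp
      exact_mod_cast hr
  have h1 : laplacian (realTrigPoly S (fun k => (((4 * Real.pi ^ 2 * ν * freqNormSq k)⁻¹ : ℝ) : ℂ) •
      Torus.lerayCoeff k (coeffExt S c k))) x =
        realTrigPoly S (fun k => (((-ν⁻¹ : ℝ)) : ℂ) • Torus.lerayCoeff k (coeffExt S c k)) x := by
    rw [laplacian_realTrigPoly]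
    exact congrFun (realTrigPoly_congr fun k _ => hcoef k) x
  -- pattern from Literature/Analysis/FluidPDE/NSGalerkinCrossIdentity.lean (`realTrigPoly_real_smul`)
  have h2 : realTrigPoly S (fun k => (((-ν⁻¹ : ℝ)) : ℂ) • Torus.lerayCoeff k (coeffExt S c k)) x =
      (-ν⁻¹ : ℝ) • force S c x := by
    show _ = (-ν⁻¹ : ℝ) • realTrigPoly S (fun k => Torus.lerayCoeff k (coeffExt S c k)) x
    simp only [realTrigPoly_apply, trigPoly_apply, Complex.coe_smul, ← map_smul, Finset.smul_sum]
    congr 1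
    exact Finset.sum_congr rfl fun k _ =>
      (smul_comm (-ν⁻¹ : ℝ) (UnitAddTorus.mFourier k x) (Torus.lerayCoeff k (coeffExt S c k))).symm
  rw [h1, h2, smul_smul, mul_neg, mul_inv_cancel₀ hν, neg_one_smul, neg_add_cancel]

end Stokes

/-! ## §4 The sub-goal -/

/-- **Small data ⇒ window census** (registered sub-goal `smallData_mem_censusSteady` of the line
`malkin-cone-group-orbits`, the proved regime of `stub_tameDense`): there is a universal `κ > 0` such
that for `0 < ν < a`, `‖f_c‖₂ ≤ κν²`, `‖f_c‖₂² < 16π⁴ν²E` and `3ε < 2ν‖∇u_S‖₂²` (`u_S` the Stokes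
solution of `−νΔu_S = f_c`), EVERY mean-zero classical steady state `u` of `NS_ν(f_c)` has
`meanEnergy < E` and `meanDissipation > ε`, i.e. `c ∈ censusSteady S a E ε`.  Energy:
`16π⁴ν²∫‖u‖² ≤ 4π²ν²‖∇u‖₂² ≤ ‖f_c‖₂²` (energy identity, Cauchy–Schwarz, Poincaré).  Dissipation:
`ν‖∇u‖₂² = ν‖∇u_S‖₂² − b(u,u,u_S)`, `|b| ≤ C‖∇u‖₂²‖∇u_S‖₂ ≤ (ν/2)‖∇u‖₂²` for `κ = π/(C+1)`, so
`3ν‖∇u‖₂² ≥ 2ν‖∇u_S‖₂² > 3ε` (Temam 1979, Ch. II §1). [folklore] -/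
theorem smallData_mem_censusSteady : ∃ κ : ℝ, 0 < κ ∧ ∀ (S : Finset (Fin 3 → ℤ)) (a E ε : ℝ) (c : Coeff S) (ν : ℝ), 0 < ν → ν < a → Real.sqrt (∫ x, ‖force S c x‖ ^ 2) ≤ κ * ν ^ 2 → (∫ x, ‖force S c x‖ ^ 2) < 16 * Real.pi ^ 4 * ν ^ 2 * E → 3 * ε < 2 * ν * gradNormSq (realTrigPoly S (fun k => (((4 * Real.pi ^ 2 * ν * freqNormSq k)⁻¹ : ℝ) : ℂ) • Torus.lerayCoeff k (coeffExt S c k))) → c ∈ censusSteady S a E ε := by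
  obtain ⟨C₀, hC₀, hC⟩ := exists_abs_trilinear_le
  refine ⟨Real.pi / (C₀ + 1), by positivity, ?_⟩
  intro S a E ε c ν hν hνa hsmall hE hε
  have hν' : ν ≠ 0 := hν.ne'
  set f := force S c with hfdef
  set uS := realTrigPoly S (fun k => (((4 * Real.pi ^ 2 * ν * freqNormSq k)⁻¹ : ℝ) : ℂ) •
    Torus.lerayCoeff k (coeffExt S c k)) with huSdef
  have hf : IsSmooth f := CensusInterior.isSmooth_force c
  have hF0 : 0 ≤ ∫ x, ‖f x‖ ^ 2 := integral_nonneg fun _ => sq_nonneg _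
  have huS : IsSmooth uS := isSmooth_realTrigPoly _ _
  have huSdiv : IsDivFree uS := isDivFree_smul_force c fun k => (4 * Real.pi ^ 2 * ν * freqNormSq k)⁻¹
  have huS0 : HasZeroMean uS := hasZeroMean_smul_force c fun k => (4 * Real.pi ^ 2 * ν * freqNormSq k)⁻¹
  have hSt : ∀ x, ν • laplacian uS x + f x = 0 := stokes_eq hν' c
  have hGS0 : 0 ≤ gradNormSq uS := gradNormSq_nonneg uS
  -- the Stokes solution: `ν‖∇u_S‖₂² = ∫⟪f, u_S⟫`, hence `4π²ν²‖∇u_S‖₂² ≤ ‖f‖₂² ≤ κ²ν⁴`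
  have hSe : ν * gradNormSq uS = ∫ x, ⟪f x, uS x⟫ := by
    have e : ∀ x, ⟪f x, uS x⟫ = -ν * ⟪uS x, laplacian uS x⟫ := fun x => by
      rw [eq_neg_of_add_eq_zero_right (hSt x), inner_neg_left, real_inner_smul_left,
        real_inner_comm (laplacian uS x) (uS x)]
      ring
    simp_rw [e]
    rw [integral_const_mul, integral_inner_laplacian_self huS]
    ring
  have hGSF : 4 * Real.pi ^ 2 * ν ^ 2 * gradNormSq uS ≤ ∫ x, ‖f x‖ ^ 2 :=
    gradNormSq_le_of_energy_eq (hf.memLp 2) huS huS0 hSe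
  -- smallness: `2πν‖∇u_S‖₂ ≤ ‖f‖₂ ≤ κν²`, so `C₀‖∇u_S‖₂ ≤ C₀ν/(2(C₀+1)) ≤ ν/2`
  have hC₀GS : C₀ * Real.sqrt (gradNormSq uS) ≤ ν / 2 := by
    set s := Real.sqrt (gradNormSq uS) with hs
    have hs0 : 0 ≤ s := Real.sqrt_nonneg _
    have h1 : (2 * Real.pi * ν * s) ^ 2 ≤ (Real.pi / (C₀ + 1) * ν ^ 2) ^ 2 := by
      have h := pow_le_pow_left₀ (Real.sqrt_nonneg _) hsmall 2
      rw [Real.sq_sqrt hF0] at h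
      calc (2 * Real.pi * ν * s) ^ 2 = 4 * Real.pi ^ 2 * ν ^ 2 * gradNormSq uS := by
            rw [mul_pow, hs, Real.sq_sqrt hGS0]; ring
        _ ≤ _ := hGSF.trans h
    have h2 : 2 * Real.pi * ν * s ≤ Real.pi / (C₀ + 1) * ν ^ 2 :=
      (pow_le_pow_iff_left₀ (by positivity) (by positivity) two_ne_zero).1 h1
    rw [div_mul_eq_mul_div, le_div_iff₀ (by positivity : (0 : ℝ) < C₀ + 1)] at h2
    have h3 : Real.pi * ν * (2 * s * (C₀ + 1)) ≤ Real.pi * ν * ν := by nlinarith [h2]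
    have h4 := le_of_mul_le_mul_left h3 (by positivity)
    nlinarith [h4, hs0, hC₀]
  -- the census at viscosity `ν`
  refine ⟨ν, hν, hνa, fun u p hst hu0 => ?_⟩
  have hu : IsSmooth u := hst.smooth_velocity.isSmooth_slice (Set.mem_univ (0 : ℝ))
  have hdiv : IsDivFree u := hst.divFree 0 (Set.mem_univ _)
  have hG0 : 0 ≤ gradNormSq u := gradNormSq_nonneg u
  -- (a) energy identity, enstrophy bound, Poincaré
  have hEn : ν * gradNormSq u = ∫ x, ⟪f x, u x⟫ := energy_eq_of_isSteadyNSState hst hf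
  have hGF : 4 * Real.pi ^ 2 * ν ^ 2 * gradNormSq u ≤ ∫ x, ‖f x‖ ^ 2 :=
    gradNormSq_le_of_energy_eq (hf.memLp 2) hu hu0 hEn
  have hP : 4 * Real.pi ^ 2 * ∫ x, ‖u x‖ ^ 2 ≤ gradNormSq u :=
    Torus.integral_norm_sq_le_gradNormSq_of_hasZeroMean hu hu0
  -- (b) testing against `u_S`: `b(u,u,u_S) = ν‖∇u_S‖₂² − ν‖∇u‖₂²`
  have hb : ∫ x, ⟪convect u u x, uS x⟫ = ν * gradNormSq uS - ν * gradNormSq u := by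
    rw [integral_inner_convect_eq_of_isSteadyNSState hst hf huS huSdiv, ← hSe]
    have e : ∀ x, ⟪u x, laplacian uS x⟫ = -ν⁻¹ * ⟪f x, u x⟫ := fun x => by
      have h1 : laplacian uS x = -ν⁻¹ • f x := by
        have h2 : ν • laplacian uS x = -f x := eq_neg_of_add_eq_zero_left (hSt x)
        calc laplacian uS x = ν⁻¹ • (ν • laplacian uS x) := by
              rw [smul_smul, inv_mul_cancel₀ hν', one_smul]
          _ = -ν⁻¹ • f x := by rw [h2, smul_neg, neg_smul]
      rw [h1, real_inner_smul_right, real_inner_comm (f x) (u x)]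
    simp_rw [e]
    rw [integral_const_mul, ← hEn]
    field_simp
    ring
  have hbabs : |∫ x, ⟪convect u u x, uS x⟫| ≤ C₀ * gradNormSq u * Real.sqrt (gradNormSq uS) :=
    hC u uS hu hdiv hu0 huS
  have hkey : ν * gradNormSq uS - ν * gradNormSq u ≤ gradNormSq u * (ν / 2) := by
    rw [← hb]
    exact ((le_abs_self _).trans hbabs).trans (by nlinarith [mul_le_mul_of_nonneg_left hC₀GS hG0])
  -- (c) the budgets `∫‖u‖² < E` and `ε < ν‖∇u‖₂²`
  refine ⟨?_, ?_⟩
  · rw [SteadyWindow.meanEnergy_const]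
    have h1 : 16 * Real.pi ^ 4 * ν ^ 2 * ∫ x, ‖u x‖ ^ 2 ≤ ∫ x, ‖f x‖ ^ 2 :=
      calc 16 * Real.pi ^ 4 * ν ^ 2 * ∫ x, ‖u x‖ ^ 2
          = 4 * Real.pi ^ 2 * ν ^ 2 * (4 * Real.pi ^ 2 * ∫ x, ‖u x‖ ^ 2) := by ring
        _ ≤ 4 * Real.pi ^ 2 * ν ^ 2 * gradNormSq u := mul_le_mul_of_nonneg_left hP (by positivity)
        _ ≤ ∫ x, ‖f x‖ ^ 2 := hGF
    exact lt_of_mul_lt_mul_left (h1.trans_lt hE) (by positivity)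
  · rw [SteadyWindow.meanDissipation_const ν hu]
    linarith

end Summit.AnomalousDissipation.AnomalousDissipation.Theorems.RobustLoudUpgrade.SmallData

end
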